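import Literature.MathematicalPhysics.QuantumFieldTheory.Balaban1983to89.Beta.AliasingTail

/-!
# `Balaban1983to89.Beta.AliasingTailL1` — the `ℓ¹`-RATE aliasing tail (all coordinates shifted at once)

`B4ContourShift` proves the Paley–Wiener decay `‖K(x)‖ ≤ M e^{-κ|x|_∞}` of the lattice kernel of a strip-regular multiplier
by shifting the contour in ONE coordinate direction (the direction of the largest `|x_i|`), and lists as NOT IN SCOPE (d) "the
`ℓ¹`-rate form … (all coordinates shifted at once, which needs holomorphy of slices through COMPLEX base points)".  This module
supplies exactly that form.  Under `StripRegularC G κ M` — continuity and the bound `M` on the closed polystrip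
`|Re p_μ| ≤ π, |Im p_μ| ≤ κ`, and, for every coordinate `i` and every base point of the polystrip in the remaining coordinates
(complex, not only real), holomorphy of the slice `z ↦ G(insertNth i z q)` on the open rectangle with matching vertical sides —
the coordinates are shifted one after the other to `Im p_μ = κ·sgn x_μ` (induction on the set of shifted coordinates, the
intermediate functions being regular on polystrips with per-coordinate half-widths, `PolyRegular`), giving
`‖K(x)‖ ≤ M e^{-κ|x|_1}` (`latticeKernel_decay_l1`).  Consequently the periodisation remainder improves from
`aliasConst κ N d = e^{-κN}((3-ρ)/(1-ρ))^{d+1}`, `ρ = e^{-κN/(d+1)}` (sup-norm decay, `AliasingTail`) to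
`aliasConstL1 κ N d = ((1+ρ₁)/(1-ρ₁))^{d+1} − 1`, `ρ₁ = e^{-κN}` (`norm_tsum_translate_sub_le_l1`), i.e. from `≈ 3^{d+1} e^{-κN}`
to `≈ 2(d+1) e^{-κN}` — at `(κ, N, d) = (9/10, 16, 3)` from `4.9e-5` to `4.5e-6`.  The torus reading and the certified-enclosure
reading are restated with the new constant (`norm_torusKernel_zero_sub_latticeKernel_zero_le_l1`, `latticeKernel_zero_re_ge_l1`,
`lo_le_of_aliasing_l1`).

CITATION HEADER (lean-in-tree rule 2026-08-18).  Source: T. Bałaban, *Propagators and renormalization transformations for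
lattice gauge theories. I*, Commun. Math. Phys. **95**, 17–40 (1984) [Balaban1984PropagatorsI] (cell paper B5; held
`paper:balaban1984-cmp95-propagators-rt-i`, PDF page = journal page − 16).  Locators (dictionary only, quoted verbatim in the
header of `B4TorusKernel`): p. 36 l. 20–23 «Probably the simplest proof of the exponential decay properties can be obtained by
relating G on the torus to G on the whole lattice ηZ^d in the usual way» and p. 38 (1.126) (exponential decay of kernels).
No formula of the source is newly quoted or used here; the content of this module is the [folklore] multi-dimensional contour
shift and the [folklore] estimate of the Poisson summation remainder with the `ℓ¹` product majorant.

HONEST FRAMING (cell rule, verbatim, page 1 of everything): discharging BetaPertH makes Bałaban's UV stability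
UNCONDITIONAL — a real constructive-QFT result; it is NOT the continuum limit and NOT the Clay problem.
ABSOLUTE RULE (cell rule, verbatim): "No internally-minted statement may enter as a cited fact. Every hypothesis is either
kernel-proved in this package or a verbatim quotation of a PUBLISHED theorem with page reference."  Everything below is
kernel-proved; nothing is asserted about any coefficient of Bałaban's: the module bounds an abstract Fourier integral and an
abstract periodisation remainder.  USE (cell file BETA/CAP-KERNEL.md §4.8/§4.10, computer-assisted one-loop lane, route C):
with `G` the Bloch-momentum integrand of a one-loop coefficient, certified (outside the kernel) holomorphic near and bounded by
`M` on the closed polystrip `|Im q_μ| ≤ κ`, the engines' grid value `T_N` and the coefficient `c = latticeKernel G 0` satisfy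
`‖T_N − c‖ ≤ M · aliasConstL1 κ N d`.  Value = kernel-checked folklore estimate (export interface of the CAP lane), NOT summit
progress (audit cell `pub-balaban`, β sub-cell, lane cap3 = kernel algebra + export, unit `b2b-balaban-beta-cap3`, gen 5).
No `sorry`, no axiom, no `opaque`.
-/

namespace Literature.MathematicalPhysics.QuantumFieldTheory.Balaban1983to89.Beta.AliasingTailL1

open Complex Set MeasureTheory intervalIntegral
open Literature.MathematicalPhysics.QuantumFieldTheory.Balaban1983to89.B4Strip (ofRealVec Strip)
open Literature.MathematicalPhysics.QuantumFieldTheory.Balaban1983to89.B4ContourShift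
open Literature.MathematicalPhysics.QuantumFieldTheory.Balaban1983to89.B4TorusKernel
open Literature.MathematicalPhysics.QuantumFieldTheory.Balaban1983to89.Beta.AliasingTail
open scoped Real Interval

noncomputable section

variable {d : ℕ}

/-! ### §1. The `ℓ¹` norm of a lattice vector -/

/-- the `ℓ¹` norm `|x|_1 = Σ_i |x_i|` of `x ∈ ℤ^{d+1}`, as a real number. [folklore] -/
def l1Norm (x : Fin (d + 1) → ℤ) : ℝ := ∑ i, |((x i : ℤ) : ℝ)|

/-- `|x|_1 ≥ 0`. [folklore] -/
theorem l1Norm_nonneg (x : Fin (d + 1) → ℤ) : 0 ≤ l1Norm x :=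
  Finset.sum_nonneg fun _ _ => abs_nonneg _

/-- `|x|_∞ ≤ |x|_1`. [folklore] -/
theorem supNorm_le_l1Norm (x : Fin (d + 1) → ℤ) : supNorm x ≤ l1Norm x := by
  obtain ⟨i, hi⟩ := exists_supNorm_eq x
  rw [hi, Int.cast_abs]
  unfold l1Norm
  exact Finset.single_le_sum (f := fun j => |((x j : ℤ) : ℝ)|) (fun j _ => abs_nonneg _) (Finset.mem_univ i)

/-- `|N m|_1 = N |m|_1`. [folklore] -/
theorem l1Norm_translate_zero (N : ℕ) (m : Fin (d + 1) → ℤ) : l1Norm (translate N 0 m) = N * l1Norm m := by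
  unfold l1Norm
  rw [Finset.mul_sum]
  refine Finset.sum_congr rfl fun i _ => ?_
  rw [translate_zero_apply]; push_cast
  rw [abs_mul, abs_of_nonneg (by positivity : (0 : ℝ) ≤ N)]

/-- an `ℓ¹`-decay bound implies the sup-norm decay bound with the same constants. [folklore] -/
theorem supDecay_of_l1Decay (K : (Fin (d + 1) → ℤ) → ℂ) {κ M : ℝ} (hκ : 0 ≤ κ) (hM : 0 ≤ M)
    (hK : ∀ y, ‖K y‖ ≤ M * Real.exp (-(κ * l1Norm y))) (y : Fin (d + 1) → ℤ) :
    ‖K y‖ ≤ M * Real.exp (-(κ * supNorm y)) := by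
  refine (hK y).trans (mul_le_mul_of_nonneg_left (Real.exp_le_exp.mpr ?_) hM)
  have := mul_le_mul_of_nonneg_left (supNorm_le_l1Norm y) hκ
  linarith

/-! ### §2. Polystrips with per-coordinate half-widths; regularity with slices through complex base points -/

/-- the closed POLYSTRIP `|Re p_μ| ≤ π, |Im p_μ| ≤ w_μ` with per-coordinate half-widths `w`. [folklore] -/
def PolyStrip {n : ℕ} (w : Fin n → ℝ) : Set (Fin n → ℂ) := {p | ∀ μ, |(p μ).re| ≤ π ∧ |(p μ).im| ≤ w μ}

/-- with constant half-widths the polystrip is `B4Strip.Strip`. [folklore] -/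
theorem polyStrip_const (n : ℕ) (κ : ℝ) : PolyStrip (fun _ : Fin n => κ) = Strip n κ := rfl

/-- a real momentum of the Brillouin zone lies in every polystrip of nonnegative half-widths. [folklore] -/
theorem ofRealVec_mem_polyStrip {n : ℕ} {w : Fin n → ℝ} (hw : ∀ j, 0 ≤ w j) {p : Fin n → ℝ} (hp : p ∈ BZ n) :
    ofRealVec p ∈ PolyStrip w := by
  intro μ
  refine ⟨?_, by simpa [ofRealVec] using hw μ⟩
  simp only [ofRealVec, ofReal_re]
  exact abs_le.mpr ⟨hp.1 μ, hp.2 μ⟩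

/-- inserting a point of the closed rectangle of half-width `w_i` at coordinate `i` into a real momentum gives a point of
the polystrip. [folklore] -/
theorem insertNth_mem_polyStrip {w : Fin (d + 1) → ℝ} (hw : ∀ j, 0 ≤ w j) (i : Fin (d + 1)) {q : Fin d → ℝ}
    (hq : q ∈ BZ d) {z : ℂ} (hz : z ∈ closedRect (w i)) : i.insertNth z (ofRealVec q) ∈ PolyStrip w := by
  intro j
  refine Fin.succAboveCases i ?_ ?_ j
  · rw [Fin.insertNth_apply_same]
    have h1 := hz.1
    have h2 := hz.2
    simp only [mem_preimage] at h1 h2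
    rw [uIcc_of_le (by linarith [Real.pi_pos] : -π ≤ π)] at h1
    rw [uIcc_of_le (by linarith [hw i] : -w i ≤ w i)] at h2
    exact ⟨abs_le.mpr ⟨h1.1, h1.2⟩, abs_le.mpr ⟨h2.1, h2.2⟩⟩
  · intro k
    rw [Fin.insertNth_apply_succAbove]
    exact ofRealVec_mem_polyStrip (fun _ => hw _) hq k

/-- POLY-REGULARITY of a multiplier `G` with per-coordinate half-widths `w` and bound `M`: continuity and the bound on the
polystrip, and for every coordinate `i` and every base point `q` of the polystrip in the remaining coordinates (COMPLEX base
points), holomorphy of the slice `z ↦ G(insertNth i z q)` on the open rectangle of half-width `w_i` with matching vertical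
sides on the closed one. [folklore] -/
structure PolyRegular (G : (Fin (d + 1) → ℂ) → ℂ) (w : Fin (d + 1) → ℝ) (M : ℝ) : Prop where
  cont : ContinuousOn G (PolyStrip w)
  diff : ∀ (i : Fin (d + 1)) (q : Fin d → ℂ), q ∈ PolyStrip (fun j => w (i.succAbove j)) →
    DifferentiableOn ℂ (fun z => G (i.insertNth z q)) (openRect (w i))
  sides : ∀ (i : Fin (d + 1)) (q : Fin d → ℂ), q ∈ PolyStrip (fun j => w (i.succAbove j)) → ∀ y : ℝ, |y| ≤ w i →
    G (i.insertNth (-π + y * I) q) = G (i.insertNth (π + y * I) q)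
  bound : ∀ p ∈ PolyStrip w, ‖G p‖ ≤ M

/-- STRIP REGULARITY WITH COMPLEX BASE POINTS: `PolyRegular` with all half-widths equal to `κ` — the hypothesis of the
`ℓ¹`-rate decay (what a multiplier holomorphic near the closed polystrip `|Im p_μ| ≤ κ` satisfies). [folklore] -/
def StripRegularC (G : (Fin (d + 1) → ℂ) → ℂ) (κ M : ℝ) : Prop := PolyRegular G (fun _ => κ) M

/-- `StripRegularC` implies `B4ContourShift.StripRegular` (slices through real base points only). [folklore] -/
theorem StripRegularC.toStripRegular {G : (Fin (d + 1) → ℂ) → ℂ} {κ M : ℝ} (h : StripRegularC G κ M) (hκ : 0 ≤ κ) :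
    StripRegular G κ M where
  cont := h.cont
  diff := fun i q hq => h.diff i (ofRealVec q) (ofRealVec_mem_polyStrip (fun _ => hκ) hq)
  sides := fun i q hq => h.sides i (ofRealVec q) (ofRealVec_mem_polyStrip (fun _ => hκ) hq)
  bound := h.bound

/-- a poly-regular multiplier is slice regular (real base points) in every direction, with that direction's half-width. [folklore] -/
theorem PolyRegular.sliceRegular {G : (Fin (d + 1) → ℂ) → ℂ} {w : Fin (d + 1) → ℝ} {M : ℝ} (h : PolyRegular G w M)
    (hw : ∀ j, 0 ≤ w j) (i : Fin (d + 1)) : SliceRegular G i (w i) M := by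
  intro q hq
  have hq' : ofRealVec q ∈ PolyStrip (fun j => w (i.succAbove j)) := ofRealVec_mem_polyStrip (fun j => hw _) hq
  have hmaps : MapsTo (fun z : ℂ => (i.insertNth z (ofRealVec q) : Fin (d + 1) → ℂ)) (closedRect (w i)) (PolyStrip w) :=
    fun z hz => insertNth_mem_polyStrip hw i hq hz
  have hcont : Continuous (fun z : ℂ => (i.insertNth z (ofRealVec q) : Fin (d + 1) → ℂ)) := by
    apply Continuous.finInsertNth
    · exact continuous_id
    · exact continuous_const
  exact ⟨h.cont.comp hcont.continuousOn hmaps, h.diff i _ hq', h.sides i _ hq', fun z hz => h.bound _ (hmaps hz)⟩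

/-- a poly-regular multiplier (nonnegative half-widths) has an integrable integrand on the Brillouin zone. [folklore] -/
theorem PolyRegular.integrableOn {G : (Fin (d + 1) → ℂ) → ℂ} {w : Fin (d + 1) → ℝ} {M : ℝ} (h : PolyRegular G w M)
    (hw : ∀ j, 0 ≤ w j) (x : Fin (d + 1) → ℤ) : IntegrableOn (integrand G x) (BZ (d + 1)) := by
  have hc : ContinuousOn (integrand G x) (BZ (d + 1)) := by
    refine ContinuousOn.mul ?_ ?_
    · exact h.cont.comp continuous_ofRealVec.continuousOn fun p hp => ofRealVec_mem_polyStrip hw hp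
    · refine Continuous.continuousOn ?_
      unfold phase
      fun_prop
  unfold BZ
  exact hc.integrableOn_compact isCompact_Icc

/-! ### §3. The imaginary shift in one coordinate -/

/-- updating the inserted coordinate. [folklore] -/
theorem update_insertNth_same (i : Fin (d + 1)) (z v : ℂ) (q : Fin d → ℂ) :
    Function.update (i.insertNth z q : Fin (d + 1) → ℂ) i v = i.insertNth v q := by
  funext j
  refine Fin.succAboveCases i ?_ ?_ j
  · rw [Function.update_self, Fin.insertNth_apply_same]
  · intro k
    rw [Function.update_of_ne (Fin.succAbove_ne i k), Fin.insertNth_apply_succAbove, Fin.insertNth_apply_succAbove]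

/-- updating one of the remaining coordinates. [folklore] -/
theorem update_insertNth_succAbove (i : Fin (d + 1)) (k : Fin d) (z v : ℂ) (q : Fin d → ℂ) :
    Function.update (i.insertNth z q : Fin (d + 1) → ℂ) (i.succAbove k) v = i.insertNth z (Function.update q k v) := by
  funext j
  refine Fin.succAboveCases i ?_ ?_ j
  · rw [Function.update_of_ne (Fin.succAbove_ne i k).symm, Fin.insertNth_apply_same, Fin.insertNth_apply_same]
  · intro m
    rw [Fin.insertNth_apply_succAbove]
    by_cases hmk : m = k
    · subst hmk
      rw [Function.update_self, Function.update_self]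
    · rw [Function.update_of_ne (fun e => hmk (Fin.succAbove_right_injective e)), Fin.insertNth_apply_succAbove,
        Function.update_of_ne hmk]

/-- the IMAGINARY SHIFT of `G` by `σ` in the coordinate `i`: `p ↦ G(p + iσ e_i)`. [folklore] -/
def imShift (i : Fin (d + 1)) (σ : ℝ) (G : (Fin (d + 1) → ℂ) → ℂ) : (Fin (d + 1) → ℂ) → ℂ :=
  fun p => G (Function.update p i (p i + σ * I))

/-- the shift map is continuous. [folklore] -/
theorem continuous_shiftMap (i : Fin (d + 1)) (σ : ℝ) :
    Continuous (fun p : Fin (d + 1) → ℂ => Function.update p i (p i + σ * I)) :=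
  continuous_id.update i ((continuous_apply i).add continuous_const)

/-- the shift map sends the polystrip with `i`-th half-width `0` into the polystrip with `i`-th half-width `w_i ≥ |σ|`. [folklore] -/
theorem mapsTo_shiftMap {w : Fin (d + 1) → ℝ} {i : Fin (d + 1)} {σ : ℝ} (hσ : |σ| ≤ w i) :
    MapsTo (fun p : Fin (d + 1) → ℂ => Function.update p i (p i + σ * I))
      (PolyStrip (Function.update w i 0)) (PolyStrip w) := by
  intro p hp μ
  dsimp only
  by_cases hμ : μ = i
  · subst hμ
    have h1 : |(p μ).re| ≤ π ∧ |(p μ).im| ≤ Function.update w μ 0 μ := hp μ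
    rw [Function.update_self] at h1
    rw [Function.update_self]
    simp only [add_re, mul_re, ofReal_re, I_re, mul_zero, ofReal_im, I_im, mul_one, sub_self, add_zero,
      add_im, mul_im]
    refine ⟨h1.1, ?_⟩
    rw [abs_nonpos_iff.mp h1.2, zero_add]
    exact hσ
  · have h1 : |(p μ).re| ≤ π ∧ |(p μ).im| ≤ Function.update w i 0 μ := hp μ
    rw [Function.update_of_ne hμ] at h1
    rw [Function.update_of_ne hμ]
    exact h1

/-- POLY-REGULARITY IS INHERITED BY THE SHIFT, the shifted coordinate becoming real (`w_i ↦ 0`). [folklore] -/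
theorem PolyRegular.shift {G : (Fin (d + 1) → ℂ) → ℂ} {w : Fin (d + 1) → ℝ} {M : ℝ} (h : PolyRegular G w M)
    {i : Fin (d + 1)} {σ : ℝ} (hσ : |σ| ≤ w i) :
    PolyRegular (imShift i σ G) (Function.update w i 0) M where
  cont := h.cont.comp (continuous_shiftMap i σ).continuousOn (mapsTo_shiftMap hσ)
  diff := by
    intro j q hq
    by_cases hji : j = i
    · subst hji
      rw [Function.update_self]
      intro z hz
      exfalso
      have h2 := hz.2
      simp at h2
    · obtain ⟨k, hk⟩ : ∃ k, j.succAbove k = i := Fin.exists_succAbove_eq (Ne.symm hji)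
      rw [Function.update_of_ne hji]
      have e : ∀ z, imShift i σ G (j.insertNth z q) = G (j.insertNth z (Function.update q k (q k + σ * I))) := by
        intro z
        simp only [imShift]
        rw [← hk, Fin.insertNth_apply_succAbove, update_insertNth_succAbove]
      simp_rw [e]
      apply h.diff j
      intro m
      by_cases hm : m = k
      · subst hm
        have h1 : |(q m).re| ≤ π ∧ |(q m).im| ≤ Function.update w i 0 (j.succAbove m) := hq m
        rw [hk, Function.update_self] at h1
        rw [Function.update_self]
        simp only [add_re, mul_re, ofReal_re, I_re, mul_zero, ofReal_im, I_im, mul_one, sub_self, add_zero,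
          add_im, mul_im]
        refine ⟨h1.1, ?_⟩
        rw [abs_nonpos_iff.mp h1.2, zero_add, hk]
        exact hσ
      · have h1 : |(q m).re| ≤ π ∧ |(q m).im| ≤ Function.update w i 0 (j.succAbove m) := hq m
        have hne : j.succAbove m ≠ i := fun e => hm (Fin.succAbove_right_injective (e.trans hk.symm))
        rw [Function.update_of_ne hne] at h1
        rw [Function.update_of_ne hm]
        exact h1
  sides := by
    intro j q hq y hy
    by_cases hji : j = i
    · subst hji
      rw [Function.update_self] at hy
      have hy0 : y = 0 := abs_nonpos_iff.mp hy
      subst hy0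
      simp only [imShift]
      rw [Fin.insertNth_apply_same, Fin.insertNth_apply_same, update_insertNth_same, update_insertNth_same]
      have hq' : q ∈ PolyStrip (fun j' => w (j.succAbove j')) := by
        intro m
        have h1 : |(q m).re| ≤ π ∧ |(q m).im| ≤ Function.update w j 0 (j.succAbove m) := hq m
        rw [Function.update_of_ne (Fin.succAbove_ne j m)] at h1
        exact h1
      have := h.sides j q hq' σ hσ
      push_cast
      simp only [zero_mul, add_zero]
      convert this using 2
    · obtain ⟨k, hk⟩ : ∃ k, j.succAbove k = i := Fin.exists_succAbove_eq (Ne.symm hji)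
      rw [Function.update_of_ne hji] at hy
      simp only [imShift]
      rw [← hk, Fin.insertNth_apply_succAbove, update_insertNth_succAbove, Fin.insertNth_apply_succAbove,
        update_insertNth_succAbove]
      apply h.sides j _ _ y hy
      intro m
      by_cases hm : m = k
      · subst hm
        have h1 : |(q m).re| ≤ π ∧ |(q m).im| ≤ Function.update w i 0 (j.succAbove m) := hq m
        rw [hk, Function.update_self] at h1
        rw [Function.update_self]
        simp only [add_re, mul_re, ofReal_re, I_re, mul_zero, ofReal_im, I_im, mul_one, sub_self, add_zero,
          add_im, mul_im]
        refine ⟨h1.1, ?_⟩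
        rw [abs_nonpos_iff.mp h1.2, zero_add, hk]
        exact hσ
      · have h1 : |(q m).re| ≤ π ∧ |(q m).im| ≤ Function.update w i 0 (j.succAbove m) := hq m
        have hne : j.succAbove m ≠ i := fun e => hm (Fin.succAbove_right_injective (e.trans hk.symm))
        rw [Function.update_of_ne hne] at h1
        rw [Function.update_of_ne hm]
        exact h1
  bound := fun p hp => h.bound _ (mapsTo_shiftMap hσ hp)

/-- the character on the shifted contour: `e^{i(t+iσ)x} = e^{itx} e^{-σx}`. [folklore] -/
theorem cexp_shift (x : ℤ) (t σ : ℝ) :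
    cexp (I * ((t : ℂ) + σ * I) * (x : ℂ)) = cexp (I * (t : ℂ) * (x : ℂ)) * (Real.exp (-(σ * x)) : ℂ) := by
  rw [Complex.ofReal_exp, ← Complex.exp_add]
  congr 1
  have hI : I * I = -1 := Complex.I_mul_I
  push_cast
  linear_combination (σ : ℂ) * (x : ℂ) * hI

/-- THE ONE-COORDINATE SHIFT IDENTITY: under poly-regularity and `|σ| ≤ w_i`,
`∫_{[-π,π]^{d+1}} G(p) e^{ip·x} dp = e^{-σ x_i} ∫_{[-π,π]^{d+1}} G(p + iσe_i) e^{ip·x} dp`. [folklore] -/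
theorem fourierBox_imShift {G : (Fin (d + 1) → ℂ) → ℂ} {w : Fin (d + 1) → ℝ} {M : ℝ} (h : PolyRegular G w M)
    (hw : ∀ j, 0 ≤ w j) (i : Fin (d + 1)) {σ : ℝ} (hσ : |σ| ≤ w i) (x : Fin (d + 1) → ℤ) :
    fourierBox G x = (Real.exp (-(σ * x i)) : ℂ) * fourierBox (imShift i σ G) x := by
  have h' := h.shift hσ
  have hw' : ∀ j, 0 ≤ Function.update w i 0 j := by
    intro j
    by_cases hj : j = i
    · subst hj; simp
    · rw [Function.update_of_ne hj]; exact hw j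
  have hBZ : MeasurableSet (BZ d) := by unfold BZ; exact measurableSet_Icc
  rw [fourierBox_eq_iterated G x i (h.integrableOn hw x), fourierBox_eq_iterated _ x i (h'.integrableOn hw' x),
    ← MeasureTheory.integral_const_mul]
  refine setIntegral_congr_fun hBZ fun q hq => ?_
  -- the slice data at the real base point `q`
  obtain ⟨hc, hd, hsd, -⟩ := (h.sliceRegular hw i) q hq
  set C : ℂ := cexp (I * phase q (fun j => x (i.succAbove j))) with hC
  set g : ℂ → ℂ := fun z => G (i.insertNth z (ofRealVec q)) * C * cexp (I * z * (x i)) with hg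
  have hI1 : (∫ t in Icc (-π) π, integrand G x (i.insertNth t q)) = ∫ t in (-π)..π, g t := by
    rw [intervalIntegral.integral_of_le (by linarith [Real.pi_pos] : -π ≤ π), integral_Icc_eq_integral_Ioc]
    refine setIntegral_congr_fun measurableSet_Ioc fun t _ => ?_
    simp only [integrand, hg, ofRealVec_insertNth, phase_insertNth, mul_add, Complex.exp_add, hC]
    ring
  have hI2 : (∫ t in Icc (-π) π, integrand (imShift i σ G) x (i.insertNth t q))
      = ∫ t in (-π)..π, imShift i σ G (i.insertNth (t : ℂ) (ofRealVec q)) * C * cexp (I * (t : ℂ) * (x i)) := by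
    rw [intervalIntegral.integral_of_le (by linarith [Real.pi_pos] : -π ≤ π), integral_Icc_eq_integral_Ioc]
    refine setIntegral_congr_fun measurableSet_Ioc fun t _ => ?_
    simp only [integrand, ofRealVec_insertNth, phase_insertNth, mul_add, Complex.exp_add, hC]
    ring
  have hshift : ∀ t : ℝ, g ((t : ℂ) + σ * I)
      = (Real.exp (-(σ * x i)) : ℂ) * (imShift i σ G (i.insertNth (t : ℂ) (ofRealVec q)) * C * cexp (I * (t : ℂ) * (x i))) := by
    intro t
    simp only [hg, imShift]
    rw [Fin.insertNth_apply_same, update_insertNth_same, cexp_shift (x i) t σ]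
    ring
  have hc' : ContinuousOn g (closedRect (w i)) :=
    (hc.mul continuousOn_const).mul (Continuous.continuousOn (by fun_prop))
  have hd' : DifferentiableOn ℂ g (openRect (w i)) :=
    (hd.mul (differentiableOn_const _)).mul (Differentiable.differentiableOn (by fun_prop))
  have hside' : ∀ y : ℝ, |y| ≤ w i → g (-π + y * I) = g (π + y * I) := by
    intro y hy
    simp only [hg]
    rw [hsd y hy, side_char (x i) y]
  rw [hI1, hI2, integral_shift g hσ hc' hd' hside']
  simp_rw [hshift]
  rw [intervalIntegral.integral_const_mul]

/-! ### §4. All coordinates: the `ℓ¹`-rate decay -/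

/-- the base of the induction: all half-widths zero — the trivial bound `(2π)^{d+1} M`. [folklore] -/
theorem norm_fourierBox_le_of_zero {G : (Fin (d + 1) → ℂ) → ℂ} {w : Fin (d + 1) → ℝ} {M : ℝ} (h : PolyRegular G w M)
    (hw : ∀ j, w j = 0) (x : Fin (d + 1) → ℤ) : ‖fourierBox G x‖ ≤ (2 * π) ^ (d + 1) * M := by
  have hw0 : ∀ j, 0 ≤ w j := fun j => by rw [hw j]
  have hb := norm_fourierBox_le_coord G 0 (hw0 0) x (h.integrableOn hw0 x) (h.sliceRegular hw0 0)
  simpa [hw 0] using hb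

/-- THE WEIGHTED BOUND (induction on the set `S` of coordinates with a nonzero half-width): poly-regularity with half-widths
`w` supported in `S` and shifts `|σ_j| ≤ w_j` give `|∫ G e^{ip·x}| ≤ (2π)^{d+1} M e^{-Σ_j σ_j x_j}`. [folklore] -/
theorem norm_fourierBox_le_weighted {M : ℝ} (x : Fin (d + 1) → ℤ) (S : Finset (Fin (d + 1))) :
    ∀ (w σ : Fin (d + 1) → ℝ) (G : (Fin (d + 1) → ℂ) → ℂ), (∀ j, 0 ≤ w j) → (∀ j, j ∉ S → w j = 0) →
      (∀ j, |σ j| ≤ w j) → PolyRegular G w M →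
      ‖fourierBox G x‖ ≤ (2 * π) ^ (d + 1) * M * Real.exp (-(∑ j, σ j * (x j : ℝ))) := by
  refine Finset.induction_on S ?_ ?_
  · intro w σ G hw0 hwS hσ hG
    have hw : ∀ j, w j = 0 := fun j => hwS j (by simp)
    have hσ0 : ∀ j, σ j = 0 := fun j => abs_nonpos_iff.mp ((hσ j).trans (hw j).le)
    simp only [hσ0, zero_mul, Finset.sum_const_zero, neg_zero, Real.exp_zero, mul_one]
    exact norm_fourierBox_le_of_zero hG hw x
  · intro i S hi IH w σ G hw0 hwS hσ hG
    have hw0' : ∀ j, 0 ≤ Function.update w i 0 j := by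
      intro j
      by_cases hji : j = i
      · subst hji; simp
      · rw [Function.update_of_ne hji]; exact hw0 j
    have hwS' : ∀ j, j ∉ S → Function.update w i 0 j = 0 := by
      intro j hj
      by_cases hji : j = i
      · subst hji; simp
      · rw [Function.update_of_ne hji]
        exact hwS j (by simp [Finset.mem_insert, hji, hj])
    have hσ' : ∀ j, |Function.update σ i 0 j| ≤ Function.update w i 0 j := by
      intro j
      by_cases hji : j = i
      · subst hji; simp
      · rw [Function.update_of_ne hji, Function.update_of_ne hji]; exact hσ j
    have ih := IH (Function.update w i 0) (Function.update σ i 0) (imShift i (σ i) G) hw0' hwS' hσ' (hG.shift (hσ i))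
    rw [fourierBox_imShift hG hw0 i (hσ i) x, norm_mul, Complex.norm_real, Real.norm_of_nonneg (Real.exp_pos _).le]
    have hsum : ∑ j, σ j * (x j : ℝ) = σ i * (x i : ℝ) + ∑ j, Function.update σ i 0 j * (x j : ℝ) := by
      rw [Fin.sum_univ_succAbove _ i, Fin.sum_univ_succAbove (fun j => Function.update σ i 0 j * (x j : ℝ)) i]
      simp only [Function.update_self, zero_mul, zero_add]
      congr 1
      refine Finset.sum_congr rfl fun k _ => ?_
      rw [Function.update_of_ne (Fin.succAbove_ne i k)]
    rw [hsum, neg_add, Real.exp_add]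
    calc Real.exp (-(σ i * (x i : ℝ))) * ‖fourierBox (imShift i (σ i) G) x‖
        ≤ Real.exp (-(σ i * (x i : ℝ))) * ((2 * π) ^ (d + 1) * M
            * Real.exp (-(∑ j, Function.update σ i 0 j * (x j : ℝ)))) :=
          mul_le_mul_of_nonneg_left ih (Real.exp_pos _).le
      _ = (2 * π) ^ (d + 1) * M * (Real.exp (-(σ i * (x i : ℝ)))
            * Real.exp (-(∑ j, Function.update σ i 0 j * (x j : ℝ)))) := by ring

/-- THE `ℓ¹`-RATE PALEY–WIENER DECAY: `StripRegularC G κ M`, `κ ≥ 0` ⇒ `|K(x)| ≤ M e^{-κ|x|_1}`, `x ∈ ℤ^{d+1}` (all coordinates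
shifted at once, to `Im p_μ = κ·sgn x_μ`) — the `ℓ¹`-rate form of the printed decay assertion B4 p. 586 l. 11–15 / B5 (1.126),
whose one-direction form is `B4ContourShift.latticeKernel_decay`.
[cite: Balaban1983RegularityDecay, p. 586 l. 9–15, dictionary] [cite: Balaban1984PropagatorsI, p. 38 (1.126), dictionary] [folklore] -/
theorem latticeKernel_decay_l1 {G : (Fin (d + 1) → ℂ) → ℂ} {κ M : ℝ} (h : StripRegularC G κ M) (hκ : 0 ≤ κ)
    (x : Fin (d + 1) → ℤ) : ‖latticeKernel G x‖ ≤ M * Real.exp (-(κ * l1Norm x)) := by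
  set σ : Fin (d + 1) → ℝ := fun j => if 0 ≤ x j then κ else -κ with hσdef
  have hσ : ∀ j, |σ j| ≤ κ := by
    intro j; simp only [hσdef]; split_ifs <;> simp [abs_of_nonneg hκ]
  have hσx : ∑ j, σ j * (x j : ℝ) = κ * l1Norm x := by
    unfold l1Norm
    rw [Finset.mul_sum]
    refine Finset.sum_congr rfl fun j _ => ?_
    simp only [hσdef]
    split_ifs with hx
    · rw [abs_of_nonneg (by exact_mod_cast hx)]
    · rw [abs_of_neg (by exact_mod_cast (not_le.mp hx))]; ring
  have hb := norm_fourierBox_le_weighted (M := M) x Finset.univ (fun _ => κ) σ G (fun _ => hκ)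
    (fun j hj => absurd (Finset.mem_univ j) hj) hσ h
  rw [hσx] at hb
  have hpos : (0 : ℝ) < (2 * π) ^ (d + 1) := by positivity
  unfold latticeKernel
  rw [norm_smul, Real.norm_eq_abs, abs_of_pos (inv_pos.mpr hpos)]
  calc ((2 * π) ^ (d + 1))⁻¹ * ‖fourierBox G x‖
      ≤ ((2 * π) ^ (d + 1))⁻¹ * ((2 * π) ^ (d + 1) * M * Real.exp (-(κ * l1Norm x))) :=
        mul_le_mul_of_nonneg_left hb (inv_pos.mpr hpos).le
    _ = M * Real.exp (-(κ * l1Norm x)) := by field_simp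

/-! ### §5. The `ℓ¹` aliasing constant and the aliasing tail -/

/-- the ratio `ρ₁ = e^{-κN}`. [folklore] -/
def aliasRatioL1 (κ : ℝ) (N : ℕ) : ℝ := Real.exp (-(κ * N))

/-- the `ℓ¹` ALIASING CONSTANT `A₁(κ, N, d) = ((1 + ρ₁)/(1 - ρ₁))^{d+1} − 1`, `ρ₁ = e^{-κN}`: the exact value of
`Σ_{m ∈ ℤ^{d+1}, m ≠ 0} e^{-κN|m|_1}`. [folklore] -/
def aliasConstL1 (κ : ℝ) (N d : ℕ) : ℝ := ((1 + aliasRatioL1 κ N) / (1 - aliasRatioL1 κ N)) ^ (d + 1) - 1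

/-- `ρ₁ > 0`. [folklore] -/
theorem aliasRatioL1_pos (κ : ℝ) (N : ℕ) : 0 < aliasRatioL1 κ N := Real.exp_pos _

/-- `ρ₁ < 1` for `κ > 0`, `N ≥ 1`. [folklore] -/
theorem aliasRatioL1_lt_one {κ : ℝ} (hκ : 0 < κ) {N : ℕ} (hN : 1 ≤ N) : aliasRatioL1 κ N < 1 := by
  unfold aliasRatioL1
  have : (1 : ℝ) ≤ N := by exact_mod_cast hN
  rw [← Real.exp_zero]
  exact Real.exp_lt_exp.mpr (by nlinarith)

/-- the one-dimensional weight `ρ^{|j|}`. [folklore] -/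
def absWeight (ρ : ℝ) (j : ℤ) : ℝ := ρ ^ j.natAbs

/-- the weight is nonnegative for `ρ ≥ 0`. [folklore] -/
theorem absWeight_nonneg {ρ : ℝ} (h0 : 0 ≤ ρ) (j : ℤ) : 0 ≤ absWeight ρ j := pow_nonneg h0 _

/-- `Σ_{j ∈ ℤ} ρ^{|j|} = (1 + ρ)/(1 - ρ)` for `0 ≤ ρ < 1`. [folklore] -/
theorem hasSum_absWeight {ρ : ℝ} (h0 : 0 ≤ ρ) (h1 : ρ < 1) :
    Summable (absWeight ρ) ∧ ∑' j : ℤ, absWeight ρ j = (1 + ρ) / (1 - ρ) := by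
  have hg := summable_geometric_of_lt_one h0 h1
  have hgs : ∑' n : ℕ, ρ ^ n = (1 - ρ)⁻¹ := tsum_geometric_of_lt_one h0 h1
  have hnat : (fun n : ℕ => absWeight ρ (n : ℤ)) = fun n => ρ ^ n := by
    funext n; simp only [absWeight, Int.natAbs_natCast]
  have hneg : (fun n : ℕ => absWeight ρ (-(n + 1 : ℤ))) = fun n => ρ * ρ ^ n := by
    funext n
    simp only [absWeight]
    have e : (-(n + 1 : ℤ)).natAbs = n + 1 := by omega
    rw [e, pow_succ, mul_comm]
  have h1' : Summable fun n : ℕ => absWeight ρ (n : ℤ) := by rw [hnat]; exact hg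
  have h3 : Summable fun n : ℕ => absWeight ρ (-(n + 1 : ℤ)) := by rw [hneg]; exact hg.mul_left ρ
  refine ⟨Summable.of_nat_of_neg_add_one h1' h3, ?_⟩
  rw [tsum_of_nat_of_neg_add_one h1' h3, hnat, hneg, tsum_mul_left, hgs]
  have hpos : (1 - ρ) ≠ 0 := by linarith
  field_simp

/-- `A₁ ≥ 0` for `κ > 0`, `N ≥ 1`. [folklore] -/
theorem aliasConstL1_nonneg {κ : ℝ} (hκ : 0 < κ) {N : ℕ} (hN : 1 ≤ N) (d : ℕ) : 0 ≤ aliasConstL1 κ N d := by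
  unfold aliasConstL1
  have h0 := (aliasRatioL1_pos κ N).le
  have h1 := aliasRatioL1_lt_one hκ hN
  have : (1 : ℝ) ≤ (1 + aliasRatioL1 κ N) / (1 - aliasRatioL1 κ N) := by
    rw [le_div_iff₀ (by linarith)]; linarith
  linarith [one_le_pow₀ (n := d + 1) this]

/-- THE `ℓ¹` ALIASING TAIL: `‖K(y)‖ ≤ M e^{-κ|y|_1}`, `κ > 0`, `N ≥ 1` ⇒ the periodisation `Σ_m K(Nm)` converges and
`‖Σ_{m ∈ ℤ^{d+1}} K(Nm) − K(0)‖ ≤ M · (((1+ρ₁)/(1-ρ₁))^{d+1} − 1)`, `ρ₁ = e^{-κN}` (the periodisation «in the usual way» of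
B5 p. 36, with the `ℓ¹` product majorant). [cite: Balaban1984PropagatorsI, p. 36 l. 20–23, dictionary] [folklore] -/
theorem norm_tsum_translate_sub_le_l1 (K : (Fin (d + 1) → ℤ) → ℂ) {κ M : ℝ} (hκ : 0 < κ)
    (hK : ∀ y, ‖K y‖ ≤ M * Real.exp (-(κ * l1Norm y))) {N : ℕ} (hN : 1 ≤ N) :
    Summable (fun m : Fin (d + 1) → ℤ => K (translate N 0 m)) ∧
      ‖(∑' m : Fin (d + 1) → ℤ, K (translate N 0 m)) - K 0‖ ≤ M * aliasConstL1 κ N d := by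
  have hM : 0 ≤ M := by
    have h := hK 0
    have : l1Norm (0 : Fin (d + 1) → ℤ) = 0 := by unfold l1Norm; simp
    rw [this] at h; simp at h; exact le_trans (norm_nonneg _) h
  have hK' := supDecay_of_l1Decay K hκ.le hM hK
  have hs : Summable (fun m : Fin (d + 1) → ℤ => K (translate N 0 m)) :=
    (norm_tsum_translate_sub_le K hκ hK' hN).1
  refine ⟨hs, ?_⟩
  set ρ := aliasRatioL1 κ N with hρ
  have hρ0 : 0 ≤ ρ := (aliasRatioL1_pos κ N).le
  have hρ1 : ρ < 1 := aliasRatioL1_lt_one hκ hN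
  -- the off-centre part as an `ite`
  set g : (Fin (d + 1) → ℤ) → ℂ := fun m => if m = 0 then 0 else K (translate N 0 m) with hg
  have hdecomp : (∑' m : Fin (d + 1) → ℤ, K (translate N 0 m)) = K 0 + ∑' m, g m := by
    have := hs.tsum_eq_add_tsum_ite 0
    simpa [hg] using this
  rw [hdecomp, add_sub_cancel_left]
  -- the full product majorant and its off-centre part
  set F₀ : (Fin (d + 1) → ℤ) → ℝ := fun m => M * ∏ i, absWeight ρ (m i) with hF₀
  set F : (Fin (d + 1) → ℤ) → ℝ := fun m => if m = 0 then 0 else F₀ m with hF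
  have hw := hasSum_absWeight hρ0 hρ1
  have hprod := summable_prod_pi (fun (_ : Fin (d + 1)) (j : ℤ) => absWeight ρ j) (fun _ j => absWeight_nonneg hρ0 j)
    (fun _ => hw.1)
  have hF₀s : Summable F₀ := hprod.1.mul_left M
  have hF₀sum : ∑' m, F₀ m = M * ((1 + ρ) / (1 - ρ)) ^ (d + 1) := by
    rw [hF₀]
    change ∑' m : Fin (d + 1) → ℤ, M * ∏ i, absWeight ρ (m i) = _
    rw [tsum_mul_left, hprod.2]
    simp only [Finset.prod_const, Finset.card_univ, Fintype.card_fin]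
    rw [hw.2]
  have hF₀0 : F₀ 0 = M := by simp [hF₀, absWeight]
  have hF₀nn : ∀ m, 0 ≤ F₀ m := fun m => mul_nonneg hM (Finset.prod_nonneg fun i _ => absWeight_nonneg hρ0 _)
  have hFs : Summable F := by
    refine Summable.of_nonneg_of_le (fun m => ?_) (fun m => ?_) hF₀s
    · simp only [hF]; split_ifs
      · exact le_rfl
      · exact hF₀nn m
    · simp only [hF]; split_ifs
      · exact hF₀nn m
      · exact le_rfl
  have hFsum : ∑' m, F m = M * aliasConstL1 κ N d := by
    have hsplit := hF₀s.tsum_eq_add_tsum_ite 0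
    have hF' : (fun m => if m = 0 then 0 else F₀ m) = F := by rfl
    rw [hF', hF₀sum, hF₀0] at hsplit
    unfold aliasConstL1; rw [← hρ]
    linarith
  have hgF : ∀ m, ‖g m‖ ≤ F m := by
    intro m
    rcases eq_or_ne m 0 with rfl | hm
    · simp [hg, hF]
    · simp only [hg, hm, if_false, hF, hF₀]
      have key : Real.exp (-(κ * l1Norm (translate N 0 m))) = ∏ i, absWeight ρ (m i) := by
        rw [l1Norm_translate_zero]
        unfold l1Norm
        have e : -(κ * ((N : ℝ) * ∑ i, |((m i : ℤ) : ℝ)|)) = ∑ i, ((m i).natAbs : ℝ) * (-(κ * N)) := by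
          rw [Finset.mul_sum, Finset.mul_sum, ← Finset.sum_neg_distrib]
          refine Finset.sum_congr rfl fun i _ => ?_
          rw [Nat.cast_natAbs, Int.cast_abs]; ring
        rw [e, Real.exp_sum]
        refine Finset.prod_congr rfl fun i _ => ?_
        rw [Real.exp_nat_mul, hρ]
        rfl
      calc ‖K (translate N 0 m)‖ ≤ M * Real.exp (-(κ * l1Norm (translate N 0 m))) := hK _
        _ = M * ∏ i, absWeight ρ (m i) := by rw [key]
  have hgs : Summable (fun m => ‖g m‖) := Summable.of_nonneg_of_le (fun m => norm_nonneg _) hgF hFs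
  calc ‖∑' m, g m‖ ≤ ∑' m, ‖g m‖ := norm_tsum_le_tsum_norm hgs
    _ ≤ ∑' m, F m := hgs.tsum_le_tsum hgF hFs
    _ = M * aliasConstL1 κ N d := hFsum

/-! ### §6. The torus reading and the certified-enclosure reading with the `ℓ¹` constant -/

/-- GRID SUM VERSUS BRILLOUIN-ZONE MEAN, `ℓ¹` rate: `StripRegularC G κ M`, `κ > 0`, `N ≥ 1` ⇒
`‖N^{-(d+1)} Σ_{k ∈ (ℤ/N)^{d+1}} G(2π rep(k/N)) − latticeKernel G 0‖ ≤ M · aliasConstL1 κ N d`.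
[cite: Balaban1984PropagatorsI, p. 36 l. 20–23 with p. 38 (1.126), dictionary] [folklore] -/
theorem norm_torusKernel_zero_sub_latticeKernel_zero_le_l1 {G : (Fin (d + 1) → ℂ) → ℂ} {κ M : ℝ}
    (h : StripRegularC G κ M) (hκ : 0 < κ) {N : ℕ} (hN : 1 ≤ N) :
    ‖torusKernel (descendC G (h.toStripRegular hκ.le) hκ.le) N 0 - latticeKernel G 0‖ ≤ M * aliasConstL1 κ N d := by
  rw [torusKernel_descend_eq (h.toStripRegular hκ.le) hκ hN 0]
  exact (norm_tsum_translate_sub_le_l1 (latticeKernel G) hκ (latticeKernel_decay_l1 h hκ.le) hN).2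

/-- the same with the grid sum displayed. [cite: Balaban1984PropagatorsI, p. 36 l. 20–23 with p. 38 (1.126), dictionary] [folklore] -/
theorem norm_gridMean_sub_latticeKernel_zero_le_l1 {G : (Fin (d + 1) → ℂ) → ℂ} {κ M : ℝ}
    (h : StripRegularC G κ M) (hκ : 0 < κ) {N : ℕ} (hN : 1 ≤ N) :
    ‖((N : ℂ) ^ (d + 1))⁻¹ * (∑ k : Fin (d + 1) → Fin N, descend G (gridPt N k)) - latticeKernel G 0‖
      ≤ M * aliasConstL1 κ N d := by
  have := norm_torusKernel_zero_sub_latticeKernel_zero_le_l1 h hκ hN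
  rw [torusKernel_zero] at this
  simpa using this

/-- the assembled statement: `StripRegularC G κ M`, `κ > 0`, `N ≥ 1`, a ball `‖T_N − t‖ ≤ r` for the grid mean ⇒
`t − r − M·aliasConstL1 κ N d ≤ Re (latticeKernel G 0)`. [cite: Balaban1984PropagatorsI, p. 36 l. 20–23 with p. 38 (1.126), dictionary] [folklore] -/
theorem latticeKernel_zero_re_ge_l1 {G : (Fin (d + 1) → ℂ) → ℂ} {κ M : ℝ}
    (h : StripRegularC G κ M) (hκ : 0 < κ) {N : ℕ} (hN : 1 ≤ N) {t r : ℝ}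
    (hT : ‖torusKernel (descendC G (h.toStripRegular hκ.le) hκ.le) N 0 - t‖ ≤ r) :
    t - r - M * aliasConstL1 κ N d ≤ (latticeKernel G 0).re :=
  re_ge_of_enclosures hT (norm_torusKernel_zero_sub_latticeKernel_zero_le_l1 h hκ hN)

/-- THE EXPORT INEQUALITY, `ℓ¹` rate (shape of `Certified.lo_le_of_aliasing`): a real `A ≥ M · aliasConstL1 κ N d` and a
rational `lo ≤ t − r − A` give `lo ≤ Re (latticeKernel G 0)`. [cite: Balaban1984PropagatorsI, p. 36 l. 20–23 with p. 38 (1.126), dictionary] [folklore] -/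
theorem lo_le_of_aliasing_l1 {G : (Fin (d + 1) → ℂ) → ℂ} {κ M : ℝ}
    (h : StripRegularC G κ M) (hκ : 0 < κ) {N : ℕ} (hN : 1 ≤ N) {t r : ℝ}
    (hT : ‖torusKernel (descendC G (h.toStripRegular hκ.le) hκ.le) N 0 - t‖ ≤ r)
    {A : ℝ} (hA : M * aliasConstL1 κ N d ≤ A) {lo : ℚ} (hlo : ((lo : ℚ) : ℝ) ≤ t - r - A) :
    ((lo : ℚ) : ℝ) ≤ (latticeKernel G 0).re := by
  have := latticeKernel_zero_re_ge_l1 h hκ hN hT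
  linarith

/-! ### §7. A rational-friendly majorant of the `ℓ¹` constant -/

/-- `(1 + ρ)/(1 - ρ)` is monotone in `ρ < 1`. [folklore] -/
theorem one_add_div_one_sub_mono {ρ ρ' : ℝ} (h : ρ ≤ ρ') (h1 : ρ' < 1) :
    (1 + ρ) / (1 - ρ) ≤ (1 + ρ') / (1 - ρ') := by
  rw [div_le_div_iff₀ (by linarith) (by linarith)]
  nlinarith

/-- MONOTONE MAJORANT: `e^{-κN} ≤ ρ' < 1` ⇒ `aliasConstL1 κ N d ≤ ((1 + ρ')/(1 − ρ'))^{d+1} − 1` (so a rational upper bound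
for `e^{-κN}`, e.g. from `Certified.exp_neg_le_inv_sum`, gives a rational bound for the constant). [folklore] -/
theorem aliasConstL1_le {κ : ℝ} {N d : ℕ} {ρ' : ℝ} (hρ : aliasRatioL1 κ N ≤ ρ') (hρ1 : ρ' < 1) :
    aliasConstL1 κ N d ≤ ((1 + ρ') / (1 - ρ')) ^ (d + 1) - 1 := by
  unfold aliasConstL1
  have h0 := (aliasRatioL1_pos κ N).le
  have hle := one_add_div_one_sub_mono hρ hρ1
  have hnn : 0 ≤ (1 + aliasRatioL1 κ N) / (1 - aliasRatioL1 κ N) :=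
    div_nonneg (by linarith) (by linarith)
  linarith [pow_le_pow_left₀ hnn hle (d + 1)]

end

end Literature.MathematicalPhysics.QuantumFieldTheory.Balaban1983to89.Beta.AliasingTailL1
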